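import Literature.NumberTheory.ConnesConsani2021.QuasiInnerProductOrder
import Literature.NumberTheory.ConnesConsani2021.QuasiInnerGaussFactors
import Literature.NumberTheory.ConnesConsani2021.QuasiInnerProductSymbol
import HarnessLib

/-!
# Connes–Consani 2021 (JNT) §2/§4.4 — the Cauchy kernels `ξ_x` are eigenvectors of
# `(1 − 𝒫) M_{κ^{(m,k)}} (1 − 𝒫)` modulo the polar part (eigenvalue `ρ_∞^{(m,k)}(ψ(x))`)

LINE 1 — LABEL: RH-FREE corpus literature (function theory / Hankel–Toeplitz bookkeeping of the
Gauss-multiplication factors `ρ_∞^{(m,k)}` of `ρ_∞ = Γ_ℝ(z)/Γ_ℝ(1−z)` on the Hardy decomposition of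
`L²(S¹)`; no positivity statement, no statement about zeros of `ζ`); bears_on: W-C/W-P (P5 sequel
vocabulary, no leaf/binder/K-path role); WHAT THIS IS NOT: any claim about RH — nothing in this file
bears on the truth of RH.  Cell `rh-crit/cc`, seat t16 g4.

Source: A. Connes, C. Consani, *Quasi-inner functions and local factors*, J. Number Theory **226** (2021)
139–167 = arXiv:2008.10974 [bib: `ConnesConsani2021QuasiInner`]; locators `pNNNN:Lnn` are chunk:line of the
materialised arXiv text.  Companion of `QuasiInnerGaussFactors.lean` / `QuasiInnerProductOrder.lean` (t17:
poles, residues, strip bounds and negative Fourier coefficients of `κ^{(m,k)} = ρ_∞^{(m,k)} ∘ ψ`),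
`QuasiInnerProductAlgebra.lean` / `QuasiInnerFactorHankel.lean` (t18: Theorem 4.8 PROVED, `thm_4_8_holds`).
THEOREMS ONLY (no definition, no named fact).

## Content (RH-FREE)

The mechanism behind the diagonal operator `D`, `Dδ_n = ρ(2πin/log p)δ_n`, of Theorem 4.4 (ii) / 4.8
(p0011:L98, p0014:L64: «the decay of the terms `|ρ_∞^{(m,k)}(2πin/log p)|` is now governed by Lemma 4.6
(i)»), isolated as a statement about ONE symbol and ALL points of the disc:

* §A (Fourier bookkeeping, any `u ∈ L^∞(S¹)`): `inner_fourierLp_mulOp_fourierLp` (`⟨e_n | u e_m⟩ =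
  û(n − m)`), `hasSum_inner_fourierLp_mulOp_xiVec`, and the **key lemma** `mulOp_xiVec_sub_hardyProjection`:
  if the negative Fourier coefficients of `u` are moments, `û(−ℓ−1) = Σ_n c_n y_n^ℓ` (`|y_n| < 1`,
  `Σ|c_n|/(1−|y_n|) < ∞`), then for `|x| < 1` at positive distance from the `y_n`,
  `(1 − 𝒫)(u ξ_x) = (⟨e_{−1} | u ξ_x⟩ + Σ_n c_n/(x − y_n)) ξ_x − Σ_n (c_n/(x − y_n)) ξ_{y_n}`
  (`ξ_x = f_x = 1/(z − x)`, Lemma 2.2) — for `u ∈ H^∞` this is the classical fact that the compression of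
  `M_u` to `(H²)^⊥` has the Cauchy kernels as eigenvectors; the polar part `Σ c_n f_{y_n}` contributes
  `f_y f_x = (f_x − f_y)/(x − y)`.
* §B (one contour computation for `ρ_∞^{(m,k)}` alone): the residue theorem on the strips
  `½ − 2mj ≤ Re w ≤ ½` for `ρ_∞^{(m,k)}(w)/((w − z₀)(2w − 3))` (poles `p_n = −2k − 2mn`, `n < j`, AND the
  extra simple pole `z₀`; tree `Literature.Analysis.Complex.integral_vertical_sub_eq_sum_of_simplePoles` with
  t17's strip/left-line bounds), `j → ∞`, and the change of variables `S¹ → ∂ℂ₋`: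
  `inner_fourierLp_negOne_mulOp_rhoFactor_xiVec` —
  `⟨e_{−1} | κ^{(m,k)} ξ_x⟩ = (1/2πi)∮ κ^{(m,k)}(v) dv/(v − x) = ρ_∞^{(m,k)}(z₀) + (2z₀ − 3) Σ_n r_n/((p_n − z₀)(2p_n − 3))`
  for `x = ψ⁻¹(z₀)`, `Re z₀ < ½` not a pole.
* §C: **`mulOp_rhoFactor_xiVec_sub_hardyProjection`** — for `0 ≤ k < m`, `Re z₀ < ½`, `x = ψ⁻¹(z₀)`
  non-real: `(1 − 𝒫)(κ^{(m,k)} ξ_x) = ρ_∞^{(m,k)}(z₀) ξ_x − Σ_n (c_n/(x − y_n)) ξ_{y_n}` with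
  `y_n = ψ⁻¹(p_n)`, `c_n = −8 r_n/(2p_n − 3)²` (t17's Hankel data of `κ^{(m,k)}`).  Along the points
  `x = x_p(n) = ψ⁻¹(2πin/log p)` of Lemma 3.5 this is the statement that `(1 − 𝒫)κ^{(m,k)}(1 − 𝒫)` acts on
  `U_−V` as `U_−V D` up to a norm-summable rank-one series, `D = diag ρ_∞^{(m,k)}(2πin/log p)`.

Nothing in this file bears on the truth of RH.
-/

noncomputable section

open _root_.MeasureTheory _root_.Complex AddCircle Filter Set
open scoped Real Topology Nat InnerProductSpace ComplexConjugate ENNReal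

namespace Literature.NumberTheory.ConnesConsani2021

namespace QuasiInner

/-! ### A. Fourier bookkeeping: `⟨e_n | M_u e_m⟩`, `⟨e_n | M_u ξ_x⟩`, and the key lemma -/

section Fourier

/-- RH-FREE. `⟨e_n | u e_m⟩ = û(n − m)` for `u ∈ L^∞(S¹)` (the matrix of the multiplication operator in the
Fourier basis; the computation by which «the negative part of the Fourier expansion of `κ`» determines
`(1 − 𝒫)κ𝒫`). [cite: ConnesConsani2021QuasiInner, §2 Thm 2.3 proof (arXiv chunk p0006:L59–L68) and §3 (p0008:L66–L69)] -/
theorem inner_fourierLp_mulOp_fourierLp (u : Lp ℂ ∞ (haarAddCircle (T := (1:ℝ)))) (n m : ℤ) :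
    ⟪fourierLp (T := 1) 2 n, mulOp haarAddCircle u (fourierLp (T := 1) 2 m)⟫_ℂ =
      fourierCoeff (T := 1) (u : AddCircle (1:ℝ) → ℂ) (n - m) := by
  simp only [fourierCoeff, smul_eq_mul]
  rw [MeasureTheory.L2.inner_def]
  refine integral_congr_ae ?_
  filter_upwards [coeFn_mulOp haarAddCircle u (fourierLp (T := 1) 2 m),
    coeFn_fourierLp (T := 1) 2 m, coeFn_fourierLp (T := 1) 2 n] with t h1 h2 h3
  rw [h1, h3, h2, RCLike.inner_apply', ← fourier_neg, show -(n - m) = -n + m by ring, fourier_add]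
  ring

/-- RH-FREE. `⟨e_n | u ξ_x⟩ = Σ_j x^j û(n + j + 1)` (`ξ_x = f_x = Σ_j x^j e_{−j−1}`, `|x| < 1`: the expansion
«`x f_x = (1 − x z⁻¹)⁻¹ − 1`» of Lemma 2.2 / Thm 2.3 paired with the matrix of `u`).
[cite: ConnesConsani2021QuasiInner, Lemma 2.2 proof (arXiv chunk p0006:L30) and Thm 2.3 proof (p0006:L59–L68)] -/
theorem hasSum_inner_fourierLp_mulOp_xiVec (u : Lp ℂ ∞ (haarAddCircle (T := (1:ℝ)))) {x : ℂ}
    (hx : ‖x‖ < 1) (n : ℤ) :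
    HasSum (fun j : ℕ => x ^ j * fourierCoeff (T := 1) (u : AddCircle (1:ℝ) → ℂ) (n + (j + 1)))
      ⟪fourierLp (T := 1) 2 n, mulOp haarAddCircle u (xiVec 1 x)⟫_ℂ := by
  have h := (((innerSL ℂ (fourierLp (T := 1) 2 n)).comp (mulOp haarAddCircle u)).hasSum
    (hasSum_xiVec (T := 1) x hx))
  simp only [ContinuousLinearMap.comp_apply, map_smul, innerSL_apply_apply, smul_eq_mul,
    inner_fourierLp_mulOp_fourierLp] at h
  convert h using 2 with j
  congr 2
  ring

/-- RH-FREE. `‖ξ_y‖ ≤ (1 − |y|)⁻¹`, from Lemma 2.2's `‖ξ_y‖² = (1 − |y|²)⁻¹ ≤ (1 − |y|)⁻²`.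
[cite: ConnesConsani2021QuasiInner, Lemma 2.2 (arXiv chunk p0006:L17–L21)] -/
theorem norm_xiVec_le {y : ℂ} (hy : ‖y‖ < 1) : ‖xiVec 1 y‖ ≤ (1 - ‖y‖)⁻¹ := by
  have h1 : 0 < 1 - ‖y‖ := by linarith
  have hsq := norm_xiVec_sq (T := 1) y hy
  have h2 : ‖xiVec 1 y‖ ^ 2 ≤ ((1 - ‖y‖)⁻¹) ^ 2 := by
    rw [hsq, inv_pow]
    refine inv_anti₀ (by positivity) ?_
    nlinarith [norm_nonneg y]
  exact (pow_le_pow_iff_left₀ (norm_nonneg _) (by positivity) two_ne_zero).1 h2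

variable (u : Lp ℂ ∞ (haarAddCircle (T := (1:ℝ)))) {y c : ℕ → ℂ} {x : ℂ} {δ : ℝ}

/-- RH-FREE. Summability of `c_n/(x − y_n)` when `|x − y_n| ≥ δ > 0` and `Σ|c_n|/(1−|y_n|) < ∞`. [folklore] -/
private theorem summable_coeff_div (hy : ∀ n, ‖y n‖ < 1) (hs : Summable fun n => ‖c n‖ * (1 - ‖y n‖)⁻¹)
    (hδ : 0 < δ) (hxy : ∀ n, δ ≤ ‖x - y n‖) (ℓ : ℕ) :
    Summable fun n => c n / (x - y n) * y n ^ ℓ := by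
  refine Summable.of_norm_bounded (hs.mul_left δ⁻¹) fun n => ?_
  have h1 : 0 < 1 - ‖y n‖ := by linarith [hy n]
  have hxy0 : 0 < ‖x - y n‖ := lt_of_lt_of_le hδ (hxy n)
  rw [norm_mul, norm_div, norm_pow]
  have hyl : ‖y n‖ ^ ℓ ≤ 1 := pow_le_one₀ (norm_nonneg _) (hy n).le
  have hc1 : ‖c n‖ ≤ ‖c n‖ * (1 - ‖y n‖)⁻¹ := by
    have : 1 ≤ (1 - ‖y n‖)⁻¹ := one_le_inv_iff₀.mpr ⟨h1, by linarith [norm_nonneg (y n)]⟩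
    nlinarith [norm_nonneg (c n)]
  calc ‖c n‖ / ‖x - y n‖ * ‖y n‖ ^ ℓ ≤ ‖c n‖ / δ * 1 := by
        refine mul_le_mul ?_ hyl (by positivity) (by positivity)
        exact div_le_div_of_nonneg_left (norm_nonneg _) hδ (hxy n)
    _ ≤ δ⁻¹ * (‖c n‖ * (1 - ‖y n‖)⁻¹) := by
        rw [mul_one, div_eq_inv_mul]
        exact mul_le_mul_of_nonneg_left hc1 (by positivity)

/-- RH-FREE. Summability in `L²` of `(c_n/(x − y_n)) ξ_{y_n}` (`‖ξ_y‖ ≤ (1−|y|)⁻¹`). [folklore] -/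
private theorem summable_coeff_div_smul_xiVec (hy : ∀ n, ‖y n‖ < 1)
    (hs : Summable fun n => ‖c n‖ * (1 - ‖y n‖)⁻¹) (hδ : 0 < δ) (hxy : ∀ n, δ ≤ ‖x - y n‖) :
    Summable fun n => (c n / (x - y n)) • xiVec 1 (y n) := by
  refine Summable.of_norm_bounded (hs.mul_left δ⁻¹) fun n => ?_
  have h1 : 0 < 1 - ‖y n‖ := by linarith [hy n]
  rw [norm_smul, norm_div]
  calc ‖c n‖ / ‖x - y n‖ * ‖xiVec 1 (y n)‖ ≤ ‖c n‖ / δ * (1 - ‖y n‖)⁻¹ :=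
        mul_le_mul (div_le_div_of_nonneg_left (norm_nonneg _) hδ (hxy n)) (norm_xiVec_le (hy n))
          (norm_nonneg _) (by positivity)
    _ = δ⁻¹ * (‖c n‖ * (1 - ‖y n‖)⁻¹) := by rw [div_eq_inv_mul]; ring

/-- RH-FREE. **Key lemma (the `H^∞`-eigenvector mechanism on `(H²)^⊥`).**  Let `u ∈ L^∞(S¹)` have negative
Fourier coefficients given by moments, `û(−ℓ−1) = Σ_n c_n y_n^ℓ` (`|y_n| < 1`, `Σ_n |c_n|/(1 − |y_n|) < ∞`),
and let `|x| < 1` stay at distance `≥ δ > 0` from all `y_n`.  Then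
`(1 − 𝒫)(u ξ_x) = d·ξ_x − Σ_n (c_n/(x − y_n)) ξ_{y_n}` with `d = ⟨e_{−1} | u ξ_x⟩ + Σ_n c_n/(x − y_n)`
(for `u ∈ H^∞` — no `c_n` — this is the classical fact that the co-analytic Toeplitz compression has the
Cauchy kernels `ξ_x = 1/(z − x)` as eigenvectors with eigenvalue `u(x)`; the polar part `Σ c_n f_{y_n}` of `u`
contributes `f_y ξ_x = (ξ_x − ξ_y)/(x − y)`).  Proof: comparison of Fourier coefficients, `⟨e_{−a−1} | u ξ_x⟩ =
Σ_j x^j û(j − a) = x^a⟨e_{−1} | u ξ_x⟩ + Σ_n c_n (x^a − y_n^a)/(x − y_n)`.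
[cite: ConnesConsani2021QuasiInner, Thm 2.3 proof mechanism (arXiv chunk p0006:L59–L68) and Thm 4.8 proof (p0014:L64); folklore (Toeplitz operators with co-analytic symbol)] -/
theorem mulOp_xiVec_sub_hardyProjection (hy : ∀ n, ‖y n‖ < 1)
    (hs : Summable fun n => ‖c n‖ * (1 - ‖y n‖)⁻¹)
    (hcoef : ∀ ℓ : ℕ, HasSum (fun n => c n * y n ^ ℓ)
      (fourierCoeff (T := 1) (u : AddCircle (1:ℝ) → ℂ) (-(ℓ + 1 : ℤ))))
    (hx : ‖x‖ < 1) (hδ : 0 < δ) (hxy : ∀ n, δ ≤ ‖x - y n‖) :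
    mulOp haarAddCircle u (xiVec 1 x) - hardyProjection 1 (mulOp haarAddCircle u (xiVec 1 x)) =
      (⟪fourierLp (T := 1) 2 (-1), mulOp haarAddCircle u (xiVec 1 x)⟫_ℂ + ∑' n, c n / (x - y n)) •
          xiVec 1 x -
        ∑' n, (c n / (x - y n)) • xiVec 1 (y n) := by
  set v := mulOp haarAddCircle u (xiVec 1 x) with hv
  set d₀ : ℂ := ⟪fourierLp (T := 1) 2 (-1), v⟫_ℂ with hd₀
  have hxy' : ∀ n, x - y n ≠ 0 := fun n h => by
    have := hxy n; rw [h, norm_zero] at this; linarith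
  have hS0 := summable_coeff_div hy hs hδ hxy 0
  simp only [pow_zero, mul_one] at hS0
  have hSv := summable_coeff_div_smul_xiVec hy hs hδ hxy
  -- the inner products of the right-hand side with the modes
  have hinnerT : ∀ N : ℤ, ⟪fourierLp (T := 1) 2 N, ∑' n, (c n / (x - y n)) • xiVec 1 (y n)⟫_ℂ =
      ∑' n, c n / (x - y n) * ⟪fourierLp (T := 1) 2 N, xiVec 1 (y n)⟫_ℂ := by
    intro N
    have h := ((innerSL ℂ (fourierLp (T := 1) 2 N)).hasSum hSv.hasSum)
    simp only [innerSL_apply_apply, inner_smul_right] at h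
    exact h.tsum_eq.symm
  -- the projection is self-adjoint and fixes / kills the modes
  have hPnat : ∀ a : ℕ, ⟪fourierLp (T := 1) 2 (a : ℤ), hardyProjection 1 v⟫_ℂ =
      ⟪fourierLp (T := 1) 2 (a : ℤ), v⟫_ℂ := by
    intro a
    have ha : (hardySpace 1).starProjection (fourierLp (T := 1) 2 (a : ℤ)) = fourierLp (T := 1) 2 (a : ℤ) :=
      hardyProjection_fourierLp_natCast a
    rw [hardyProjection, ← Submodule.inner_starProjection_left_eq_right, ha]
  have hPneg : ∀ a : ℕ, ⟪fourierLp (T := 1) 2 (-(a + 1 : ℤ)), hardyProjection 1 v⟫_ℂ = 0 := by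
    intro a
    have ha : (hardySpace 1).starProjection (fourierLp (T := 1) 2 (-(a + 1 : ℤ))) = 0 :=
      hardyProjection_fourierLp_negSucc a
    rw [hardyProjection, ← Submodule.inner_starProjection_left_eq_right, ha, inner_zero_left]
  refine eq_of_inner_fourierLp_eq 1 fun N => ?_
  rcases N with a | a
  · -- non-negative modes: both sides vanish
    have hN : (Int.ofNat a : ℤ) = (a : ℤ) := rfl
    rw [hN, inner_sub_right, hPnat a, sub_self, inner_sub_right, inner_smul_right, hinnerT,
      inner_fourierLp_natCast_xiVec 1 x hx a]
    simp only [inner_fourierLp_natCast_xiVec 1 _ (hy _) a, mul_zero, tsum_zero, sub_zero]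
  · -- the mode `e_{−a−1}`
    have hN : (Int.negSucc a : ℤ) = -(a + 1 : ℤ) := Int.negSucc_eq a
    rw [hN, inner_sub_right, hPneg a, sub_zero, inner_sub_right, inner_smul_right, hinnerT,
      inner_fourierLp_negSucc_xiVec 1 x hx a]
    simp only [inner_fourierLp_negSucc_xiVec 1 _ (hy _) a]
    -- `⟨e_{−a−1} | u ξ_x⟩ = Σ_{j<a} x^j û(j − a) + x^a d₀`
    have hser := hasSum_inner_fourierLp_mulOp_xiVec u hx (-(a + 1 : ℤ))
    have hser0 := hasSum_inner_fourierLp_mulOp_xiVec u hx (-1)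
    rw [← hv] at hser hser0
    rw [← hd₀] at hser0
    have hshift := (hasSum_nat_add_iff' a).2 hser
    -- the shifted series is `x^a d₀`
    have hshift' : HasSum (fun j : ℕ => x ^ (j + a) *
        fourierCoeff (T := 1) (u : AddCircle (1:ℝ) → ℂ) (-(a + 1 : ℤ) + ((j + a : ℕ) + 1)))
        (x ^ a * d₀) := by
      have h := hser0.mul_left (x ^ a)
      have hfun : (fun j : ℕ => x ^ (j + a) *
          fourierCoeff (T := 1) (u : AddCircle (1:ℝ) → ℂ) (-(a + 1 : ℤ) + ((j + a : ℕ) + 1))) =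
          fun i : ℕ => x ^ a * (x ^ i * fourierCoeff (T := 1) (u : AddCircle (1:ℝ) → ℂ) (-1 + (i + 1))) := by
        funext j
        have e : (-(a + 1 : ℤ) + ((j + a : ℕ) + 1)) = (-1 + ((j : ℤ) + 1) : ℤ) := by push_cast; ring
        rw [e, pow_add]
        ring
      rw [hfun]
      exact h
    have hsplit : ⟪fourierLp (T := 1) 2 (-(a + 1 : ℤ)), v⟫_ℂ =
        x ^ a * d₀ + ∑ j ∈ Finset.range a,
          x ^ j * fourierCoeff (T := 1) (u : AddCircle (1:ℝ) → ℂ) (-(a + 1 : ℤ) + ((j : ℤ) + 1)) := by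
      have := hshift.unique hshift'
      linear_combination this
    -- the finite part through the moments
    have hfin : ∑ j ∈ Finset.range a,
        x ^ j * fourierCoeff (T := 1) (u : AddCircle (1:ℝ) → ℂ) (-(a + 1 : ℤ) + ((j : ℤ) + 1)) =
        ∑' n, c n / (x - y n) * (x ^ a - y n ^ a) := by
      -- each coefficient is a moment: index `-(a+1)+(j+1) = -((a-1-j)+1)`
      have hterm : ∀ j ∈ Finset.range a,
          x ^ j * fourierCoeff (T := 1) (u : AddCircle (1:ℝ) → ℂ) (-(a + 1 : ℤ) + ((j : ℤ) + 1)) =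
          ∑' n, x ^ j * (c n * y n ^ (a - 1 - j)) := by
        intro j hj
        rw [Finset.mem_range] at hj
        have e : (-(a + 1 : ℤ) + ((j : ℤ) + 1)) = -((a - 1 - j : ℕ) + 1 : ℤ) := by omega
        rw [e, ← (hcoef (a - 1 - j)).tsum_eq, tsum_mul_left]
      rw [Finset.sum_congr rfl hterm]
      have hsumm : ∀ j ∈ Finset.range a, Summable fun n => x ^ j * (c n * y n ^ (a - 1 - j)) :=
        fun j _ => ((hcoef (a - 1 - j)).summable).mul_left _
      rw [← Summable.tsum_finsetSum hsumm]
      refine tsum_congr fun n => ?_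
      have hgeom : (∑ j ∈ Finset.range a, x ^ j * y n ^ (a - 1 - j)) * (x - y n) = x ^ a - y n ^ a :=
        Commute.geom_sum₂_mul (Commute.all x (y n)) a
      calc ∑ j ∈ Finset.range a, x ^ j * (c n * y n ^ (a - 1 - j))
          = c n * ∑ j ∈ Finset.range a, x ^ j * y n ^ (a - 1 - j) := by
            rw [Finset.mul_sum]; refine Finset.sum_congr rfl fun j _ => by ring
        _ = c n / (x - y n) * (x ^ a - y n ^ a) := by
            rw [← hgeom]; field_simp [hxy' n]
    rw [hsplit, hfin]
    -- assemble: `x^a d₀ + Σ c_n (x^a − y_n^a)/(x−y_n) = (d₀ + Σ c_n/(x−y_n)) x^a − Σ c_n y_n^a/(x − y_n)`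
    have hSa := summable_coeff_div hy hs hδ hxy a
    rw [add_mul, ← tsum_mul_right, add_sub_assoc, ← Summable.tsum_sub (hS0.mul_right _) hSa]
    congr 1
    · ring
    · refine tsum_congr fun n => ?_
      ring

end Fourier

/-! ### B. The Cauchy integral of `ρ_∞^{(m,k)}` against `1/((z − z₀)(2z − 3))` over `∂ℂ₋` -/

section Contour

/-- RH-FREE. `|2z − 3|² = (2 Re z − 3)² + 4 (Im z)²`. [folklore] -/
private theorem fo_normSq_two_mul_sub_three (z : ℂ) :
    ‖2 * z - 3‖ ^ 2 = (2 * z.re - 3) ^ 2 + 4 * z.im ^ 2 := by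
  rw [Complex.sq_norm, normSq_apply]
  simp
  ring

/-- RH-FREE. For `Re z ≤ ½`: `|2z − 3|² ≥ 4(1 + (Im z)²)`. [folklore] -/
private theorem fo_four_mul_le_normSq {z : ℂ} (hz : z.re ≤ 1 / 2) : 4 * (1 + z.im ^ 2) ≤ ‖2 * z - 3‖ ^ 2 := by
  rw [fo_normSq_two_mul_sub_three]
  nlinarith

/-- RH-FREE. `2|Im z| ≤ |2z − 3|`. [folklore] -/
private theorem fo_two_abs_im_le (z : ℂ) : 2 * |z.im| ≤ ‖2 * z - 3‖ := by
  have h := Complex.abs_im_le_norm (2 * z - 3)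
  have him : (2 * z - 3).im = 2 * z.im := by simp
  rw [him, abs_mul, abs_two] at h
  exact h

/-- RH-FREE. On a vertical line at horizontal distance `≥ η` from `z₀`: `η|2z − 3| ≤ (2η + |2z₀ − 3|)|z − z₀|`
(the triangle inequality `|2z−3| ≤ 2|z−z₀| + |2z₀−3|` and `η ≤ |Re(z − z₀)| ≤ |z − z₀|`). [folklore] -/
private theorem fo_eta_mul_norm_le {z z₀ : ℂ} {η : ℝ} (hη : 0 ≤ η) (h : η ≤ |z.re - z₀.re|) :
    η * ‖2 * z - 3‖ ≤ (2 * η + ‖2 * z₀ - 3‖) * ‖z - z₀‖ := by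
  have h1 : η ≤ ‖z - z₀‖ := by
    refine h.trans ?_
    have := Complex.abs_re_le_norm (z - z₀)
    simpa using this
  have h2 : ‖2 * z - 3‖ ≤ 2 * ‖z - z₀‖ + ‖2 * z₀ - 3‖ := by
    have e : 2 * z - 3 = 2 * (z - z₀) + (2 * z₀ - 3) := by ring
    rw [e]
    refine (norm_add_le _ _).trans ?_
    rw [norm_mul, Complex.norm_ofNat]
  nlinarith [norm_nonneg (2 * z₀ - 3), norm_nonneg (z - z₀)]

/-- RH-FREE. `γ_{m,k}(c + iy) ≠ 0` when `c` is not one of the poles `−2k − 2mn`. [folklore] -/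
private theorem fo_gammaFactor_ne_zero_line {m : ℕ} (hm : 0 < m) {k : ℕ} {c : ℝ}
    (hc : ∀ n : ℕ, c ≠ -(2 * k + 2 * m * n)) (y : ℝ) : gammaFactor m k ((c : ℂ) + y * I) ≠ 0 := by
  intro h
  obtain ⟨n, hn⟩ := (gammaFactor_eq_zero_iff hm k _).1 h
  apply hc n
  have := congrArg Complex.re hn
  simp at this
  linarith

/-- RH-FREE. The Cauchy-type integrand `ρ_∞^{(m,k)}(w)/((w − z₀)(2w − 3))` is complex differentiable off the
poles of `ρ_∞^{(m,k)}`, off `z₀`, in `Re w < 3/2`. [folklore] -/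
private theorem fo_differentiableAt_H {m : ℕ} (hm : 0 < m) (k : ℕ) (z₀ : ℂ) {z : ℂ}
    (hz : gammaFactor m k z ≠ 0) (hz' : z.re < 3 / 2) (hzz : z ≠ z₀) :
    DifferentiableAt ℂ (fun w : ℂ => rhoFactor m k w / ((w - z₀) * (2 * w - 3))) z := by
  have h3 : (z - z₀) * (2 * z - 3) ≠ 0 := by
    refine mul_ne_zero (sub_ne_zero.mpr hzz) ?_
    intro h
    have := congrArg Complex.re h
    simp at this
    linarith
  exact (differentiableAt_rhoFactor hm k hz).div (by fun_prop) h3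

/-- RH-FREE. Integrability of `ρ_∞^{(m,k)}(w)/((w − z₀)(2w − 3))` along a vertical line `Re w = c ≤ ½` avoiding
the poles and the abscissa of `z₀`, given `|ρ_∞^{(m,k)}| ≤ B` there: the integrand is
`O((1 + y²)⁻¹)`. [folklore] -/
private theorem fo_integrable_line {m : ℕ} (hm : 0 < m) (k : ℕ) {c B : ℝ} (hcle : c ≤ 1 / 2)
    (hc : ∀ n : ℕ, c ≠ -(2 * k + 2 * m * n)) {z₀ : ℂ} (hcz : c ≠ z₀.re)
    (hB : ∀ y : ℝ, ‖rhoFactor m k ((c : ℂ) + y * I)‖ ≤ B) :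
    Integrable fun y : ℝ => rhoFactor m k ((c : ℂ) + y * I) /
      ((((c : ℂ) + y * I) - z₀) * (2 * ((c : ℂ) + y * I) - 3)) := by
  have hB0 : 0 ≤ B := (norm_nonneg _).trans (hB 0)
  set η : ℝ := |c - z₀.re| with hηdef
  have hη : 0 < η := abs_pos.mpr (sub_ne_zero.mpr hcz)
  set K : ℝ := (2 * η + ‖2 * z₀ - 3‖) / η with hKdef
  have hK0 : 0 < K := by positivity
  have hcont : Continuous fun y : ℝ => rhoFactor m k ((c : ℂ) + y * I) /
      ((((c : ℂ) + y * I) - z₀) * (2 * ((c : ℂ) + y * I) - 3)) := by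
    refine continuous_iff_continuousAt.2 fun y => ?_
    have hG := fo_gammaFactor_ne_zero_line hm hc y
    have hre : ((c : ℂ) + y * I).re < 3 / 2 := by simp; linarith
    have hne : ((c : ℂ) + y * I) ≠ z₀ := by
      intro h
      have := congrArg Complex.re h
      simp at this
      exact hcz this
    have hline : Continuous fun y : ℝ => (c : ℂ) + y * I := by fun_prop
    exact ContinuousAt.comp (g := fun w : ℂ => rhoFactor m k w / ((w - z₀) * (2 * w - 3)))
      (f := fun y : ℝ => (c : ℂ) + y * I) (x := y) (fo_differentiableAt_H hm k z₀ hG hre hne).continuousAt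
      hline.continuousAt
  refine Integrable.mono' ((integrable_inv_one_add_sq.const_mul (B * K / 4))) hcont.aestronglyMeasurable
    (Eventually.of_forall fun y => ?_)
  set z : ℂ := (c : ℂ) + y * I with hzdef
  have hre : z.re ≤ 1 / 2 := by simpa [hzdef] using hcle
  have him : z.im = y := by simp [hzdef]
  have h4 := fo_four_mul_le_normSq hre
  rw [him] at h4
  have hzz : 0 < ‖z - z₀‖ := by
    rw [norm_pos_iff]
    intro h
    have := congrArg Complex.re h
    simp [hzdef] at this
    exact hcz (by linarith)
  have h23 : 0 < ‖2 * z - 3‖ := by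
    refine norm_pos_iff.mpr ?_
    intro h
    have := congrArg Complex.re h
    simp [hzdef] at this
    linarith
  have hg3 : η * ‖2 * z - 3‖ ≤ (2 * η + ‖2 * z₀ - 3‖) * ‖z - z₀‖ :=
    fo_eta_mul_norm_le hη.le (by simp [hzdef, hηdef])
  have hKz : ‖2 * z - 3‖ ≤ K * ‖z - z₀‖ := by
    rw [hKdef, div_mul_eq_mul_div, le_div_iff₀ hη]
    linarith
  rw [norm_div, norm_mul]
  calc ‖rhoFactor m k z‖ / (‖z - z₀‖ * ‖2 * z - 3‖)
      ≤ B / (‖2 * z - 3‖ ^ 2 / K) := by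
        refine div_le_div₀ hB0 (hB y) (by positivity) ?_
        rw [div_le_iff₀ hK0, pow_two]
        calc ‖2 * z - 3‖ * ‖2 * z - 3‖ ≤ (K * ‖z - z₀‖) * ‖2 * z - 3‖ :=
              mul_le_mul_of_nonneg_right hKz (norm_nonneg _)
          _ = ‖z - z₀‖ * ‖2 * z - 3‖ * K := by ring
    _ = B * K / ‖2 * z - 3‖ ^ 2 := by field_simp
    _ ≤ B * K / (4 * (1 + y ^ 2)) := div_le_div_of_nonneg_left (by positivity) (by positivity) h4
    _ = B * K / 4 * (1 + y ^ 2)⁻¹ := by rw [← div_div, div_eq_mul_inv]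

/-- RH-FREE. `∫_ℝ dy/(c² + 4y²) = π/(2c)` (`c > 0`). [folklore] -/
private theorem fo_integral_inv_sq_add_four_mul_sq {c : ℝ} (hc : 0 < c) :
    ∫ y : ℝ, (c ^ 2 + 4 * y ^ 2)⁻¹ = π / (2 * c) := by
  have h : (fun y : ℝ => (c ^ 2 + 4 * y ^ 2)⁻¹) =
      fun y : ℝ => (c ^ 2)⁻¹ * (fun u : ℝ => (1 + u ^ 2)⁻¹) (2 / c * y) := by
    funext y
    simp only
    rw [← mul_inv]
    congr 1
    field_simp
    ring
  rw [h, integral_const_mul, Measure.integral_comp_mul_left (fun u : ℝ => (1 + u ^ 2)⁻¹) (2 / c),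
    integral_univ_inv_one_add_sq, smul_eq_mul, inv_div, abs_of_pos (by positivity)]
  field_simp

/-- RH-FREE. **The residue theorem on `C_{R,j}` for `ρ_∞^{(m,k)}(w)/((w − z₀)(2w − 3))`, `R → ∞`**: on the strip
`½ − 2mj ≤ Re w ≤ ½` containing `z₀` (not a pole of `ρ_∞^{(m,k)}`) and the `j` simple poles
`p_n = −2k − 2mn`, `n < j` (residues `r_n` in the concrete form `ρ = Φ/(w − p_n)`), the tree's
`Literature.Analysis.Complex.integral_vertical_sub_eq_sum_of_simplePoles` gives
`∫_ℝ H(½+iy)dy − ∫_ℝ H(½−2mj+iy)dy = 2π (Σ_{n<j} r_n/((p_n − z₀)(2p_n − 3)) + ρ_∞^{(m,k)}(z₀)/(2z₀ − 3))`.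
[cite: ConnesConsani2021QuasiInner, §2 (arXiv chunk p0005:L52–L108) with Lemma 4.7 / Thm 4.8 proof (p0014:L56, L64)] -/
theorem integral_rhoFactor_cauchy_line_sub_eq_sum {m : ℕ} (hm : 0 < m) {k : ℕ} (hk : k < m) (r : ℕ → ℂ)
    (hpole : ∀ n : ℕ, ∃ Φ : ℂ → ℂ,
      DifferentiableOn ℂ Φ (Metric.ball (-(2 * (k : ℂ) + 2 * (m : ℂ) * (n : ℂ))) 1) ∧
      Φ (-(2 * (k : ℂ) + 2 * (m : ℂ) * (n : ℂ))) = r n ∧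
      ∀ z ∈ Metric.ball (-(2 * (k : ℂ) + 2 * (m : ℂ) * (n : ℂ))) 1, z ≠ -(2 * (k : ℂ) + 2 * (m : ℂ) * (n : ℂ)) →
        rhoFactor m k z = Φ z / (z - -(2 * (k : ℂ) + 2 * (m : ℂ) * (n : ℂ))))
    {z₀ : ℂ} (hz₀ : z₀.re < 1 / 2) (hG₀ : gammaFactor m k z₀ ≠ 0)
    (j : ℕ) (hj : 1 ≤ j) (hjz : 1 / 2 - 2 * m * j < z₀.re) :
    (∫ y : ℝ, rhoFactor m k ((((1 / 2 : ℝ)) : ℂ) + y * I) /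
        ((((((1 / 2 : ℝ)) : ℂ) + y * I) - z₀) * (2 * ((((1 / 2 : ℝ)) : ℂ) + y * I) - 3))) -
      ∫ y : ℝ, rhoFactor m k ((((1 / 2 - 2 * m * j : ℝ)) : ℂ) + y * I) /
        ((((((1 / 2 - 2 * m * j : ℝ)) : ℂ) + y * I) - z₀) * (2 * ((((1 / 2 - 2 * m * j : ℝ)) : ℂ) + y * I) - 3)) =
      2 * π * (∑ n ∈ Finset.range j, r n /
          ((-(2 * (k : ℂ) + 2 * (m : ℂ) * (n : ℂ)) - z₀) * (2 * (-(2 * (k : ℂ) + 2 * (m : ℂ) * (n : ℂ))) - 3)) +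
        rhoFactor m k z₀ / (2 * z₀ - 3)) := by
  classical
  have hm0 : (0 : ℝ) < m := Nat.cast_pos.mpr hm
  have hm' : (m : ℂ) ≠ 0 := Nat.cast_ne_zero.mpr hm.ne'
  have hk1 : (k : ℝ) + 1 ≤ m := by exact_mod_cast hk
  have hj1 : (1 : ℝ) ≤ j := by exact_mod_cast hj
  have hab : (1 / 2 - 2 * m * j : ℝ) < 1 / 2 := by nlinarith
  set F : ℂ → ℂ := fun w => rhoFactor m k w / ((w - z₀) * (2 * w - 3)) with hF
  set P : ℕ → ℂ := fun n => -(2 * (k : ℂ) + 2 * (m : ℂ) * (n : ℂ)) with hP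
  set rf : ℂ → ℂ := fun q => if q = z₀ then rhoFactor m k z₀ / (2 * z₀ - 3)
    else r ⌊(-q.re - 2 * k) / (2 * m)⌋₊ / ((q - z₀) * (2 * q - 3)) with hrf
  set S : Finset ℂ := insert z₀ ((Finset.range j).image P) with hS
  set U : Set ℂ := re ⁻¹' Ioo (1 / 4 - 2 * m * j) 1 with hU
  have hPre : ∀ n : ℕ, (P n).re = -(2 * k + 2 * m * n) := by intro n; simp [hP]
  have hPG : ∀ n : ℕ, gammaFactor m k (P n) = 0 := by
    intro n
    rw [gammaFactor_eq_zero_iff hm k]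
    exact ⟨n, by simp only [hP]; ring⟩
  have hPz : ∀ n : ℕ, P n ≠ z₀ := fun n h => hG₀ (h ▸ hPG n)
  have hz0S : z₀ ∉ (Finset.range j).image P := by
    simp only [Finset.mem_image, Finset.mem_range, not_exists, not_and]
    exact fun n _ h => hPz n h
  have hinj : Set.InjOn P (Finset.range j : Set ℕ) := by
    intro x _ y _ h
    have h' := congrArg Complex.re h
    rw [hPre, hPre] at h'
    have : (x : ℝ) = y := by nlinarith
    exact_mod_cast this
  have h23 : ∀ w : ℂ, w.re < 3 / 2 → (2 * w - 3) ≠ 0 := by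
    intro w hw h
    have := congrArg Complex.re h
    simp at this
    linarith
  have hrn : ∀ n : ℕ, rf (P n) = r n / ((P n - z₀) * (2 * P n - 3)) := by
    intro n
    simp only [hrf, if_neg (hPz n)]
    congr 2
    rw [hPre, show (-(-(2 * (k : ℝ) + 2 * m * n)) - 2 * k) / (2 * m) = (n : ℝ) by field_simp; ring,
      Nat.floor_natCast]
  have hr0 : rf z₀ = rhoFactor m k z₀ / (2 * z₀ - 3) := by simp only [hrf, if_pos rfl]
  have key := Literature.Analysis.Complex.integral_vertical_sub_eq_sum_of_simplePoles (F := F) hab S rf U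
    (isOpen_Ioo.preimage Complex.continuous_re) ?hKU ?hSin ?hFd ?hpole ?hinta ?hintb ?hdecay
  · rw [hS, Finset.sum_insert hz0S, Finset.sum_image hinj] at key
    simp only [hrn, hr0] at key
    rw [add_comm] at key
    simpa [hF, hP] using key
  case hKU =>
    intro z hz
    simp only [hU, mem_preimage, mem_Ioo, mem_Icc] at hz ⊢
    constructor <;> linarith [hz.1, hz.2]
  case hSin =>
    intro q hq
    rw [hS, Finset.mem_insert] at hq
    rcases hq with rfl | hq
    · exact ⟨hjz, hz₀⟩
    simp only [Finset.mem_image, Finset.mem_range] at hq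
    obtain ⟨n, hn, rfl⟩ := hq
    have hn' : (n : ℝ) + 1 ≤ j := by exact_mod_cast hn
    rw [hPre, mem_Ioo]
    constructor
    · nlinarith [n.cast_nonneg (α := ℝ), k.cast_nonneg (α := ℝ)]
    · nlinarith [n.cast_nonneg (α := ℝ), k.cast_nonneg (α := ℝ)]
  case hFd =>
    intro z hz
    obtain ⟨hzU, hzS⟩ := hz
    simp only [hU, mem_preimage, mem_Ioo] at hzU
    have hzS' : z ∉ S := hzS
    rw [hS, Finset.mem_insert, not_or] at hzS'
    have hG : gammaFactor m k z ≠ 0 := by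
      intro h
      obtain ⟨n, hn⟩ := (gammaFactor_eq_zero_iff hm k z).1 h
      apply hzS'.2
      simp only [Finset.mem_image, Finset.mem_range]
      refine ⟨n, ?_, by rw [hn, hP]; ring⟩
      have hzre : z.re = -(2 * k + 2 * n * m) := by
        have := congrArg Complex.re hn
        simp at this
        linarith
      by_contra hnj
      have : (j : ℝ) ≤ n := by exact_mod_cast not_lt.1 hnj
      nlinarith [hzU.1, k.cast_nonneg (α := ℝ)]
    exact (fo_differentiableAt_H hm k z₀ hG (by linarith [hzU.2]) hzS'.1).differentiableWithinAt
  case hpole =>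
    intro q hq
    rw [hS, Finset.mem_insert] at hq
    rcases hq with rfl | hq
    · -- the pole at `z₀` itself: `F = (ρ/(2w−3))/(w − z₀)` with `ρ` holomorphic near `z₀`
      have hcont : Continuous fun w : ℂ => (Complex.Gamma (w / (2 * (m : ℂ)) + (k : ℂ) / (m : ℂ)))⁻¹ := by
        have h1 : Continuous fun s : ℂ => (Complex.Gamma s)⁻¹ := Complex.differentiable_one_div_Gamma.continuous
        exact h1.comp (by fun_prop)
      have hopen : IsOpen {w : ℂ | (Complex.Gamma (w / (2 * (m : ℂ)) + (k : ℂ) / (m : ℂ)))⁻¹ ≠ 0} :=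
        isOpen_ne_fun hcont continuous_const
      have hmem : q ∈ {w : ℂ | (Complex.Gamma (w / (2 * (m : ℂ)) + (k : ℂ) / (m : ℂ)))⁻¹ ≠ 0} := by
        simp only [mem_setOf_eq, ne_eq, inv_eq_zero]
        exact hG₀
      obtain ⟨ε, hε, hball⟩ := Metric.isOpen_iff.1 hopen q hmem
      refine ⟨fun w => rhoFactor m k w / (2 * w - 3), Metric.ball q (min ε 1),
        Metric.ball_mem_nhds _ (lt_min hε one_pos), ?_, ?_, ?_⟩
      · intro w hw
        have hw1 : w ∈ Metric.ball q ε := Metric.ball_subset_ball (min_le_left _ _) hw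
        have hGw : gammaFactor m k w ≠ 0 := by
          have := hball hw1
          simp only [mem_setOf_eq, ne_eq, inv_eq_zero] at this
          rw [gammaFactor_def]
          exact this
        have hre : w.re < 3 / 2 := by
          have hw2 : dist w q < 1 := (Metric.mem_ball.1 hw).trans_le (min_le_right _ _)
          rw [dist_eq_norm] at hw2
          have h1 : |(w - q).re| < 1 := (abs_re_le_norm _).trans_lt hw2
          rw [abs_lt, sub_re] at h1
          linarith [h1.2]
        exact ((differentiableAt_rhoFactor hm k hGw).div (by fun_prop) (h23 w hre)).differentiableWithinAt
      · rw [hr0]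
      · intro w _ hw
        simp only [hF]
        have h1 : w - q ≠ 0 := sub_ne_zero.mpr hw
        field_simp
    · simp only [Finset.mem_image, Finset.mem_range] at hq
      obtain ⟨n, hn, rfl⟩ := hq
      obtain ⟨Φ, hΦd, hΦv, hΦeq⟩ := hpole n
      have hd0 : 0 < ‖P n - z₀‖ := norm_pos_iff.mpr (sub_ne_zero.mpr (hPz n))
      refine ⟨fun w => Φ w / ((w - z₀) * (2 * w - 3)), Metric.ball (P n) (min 1 ‖P n - z₀‖),
        Metric.ball_mem_nhds _ (lt_min one_pos hd0), ?_, ?_, ?_⟩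
      · intro w hw
        have hw1 : w ∈ Metric.ball (P n) 1 := Metric.ball_subset_ball (min_le_left _ _) hw
        have hre : w.re < 3 / 2 := by
          rw [Metric.mem_ball, dist_eq_norm] at hw1
          have h1 : |(w - P n).re| < 1 := (abs_re_le_norm _).trans_lt hw1
          rw [abs_lt, sub_re, hPre] at h1
          nlinarith [h1.2, n.cast_nonneg (α := ℝ), k.cast_nonneg (α := ℝ)]
        have hwz : w ≠ z₀ := by
          intro h
          have hw2 : dist w (P n) < ‖P n - z₀‖ := (Metric.mem_ball.1 hw).trans_le (min_le_right _ _)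
          rw [h, dist_comm, dist_eq_norm] at hw2
          exact lt_irrefl _ hw2
        have hden : (w - z₀) * (2 * w - 3) ≠ 0 := mul_ne_zero (sub_ne_zero.mpr hwz) (h23 w hre)
        have hRd : DifferentiableAt ℂ (fun w : ℂ => (w - z₀) * (2 * w - 3)) w := by fun_prop
        have hΦat : DifferentiableAt ℂ Φ w := (hΦd w hw1).differentiableAt (Metric.isOpen_ball.mem_nhds hw1)
        exact (hΦat.div hRd hden).differentiableWithinAt
      · rw [hrn n]
        simp only [hP]
        rw [hΦv]
      · intro w hw hwn
        have hw1 : w ∈ Metric.ball (P n) 1 := Metric.ball_subset_ball (min_le_left _ _) hw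
        simp only [hF]
        rw [hΦeq w hw1 hwn]
        have h1 : w - P n ≠ 0 := sub_ne_zero.mpr hwn
        simp only [hP] at h1 ⊢
        field_simp
  case hinta =>
    refine fo_integrable_line hm k hab.le ?_ (ne_of_lt hjz) (fun y => (norm_rhoFactor_leftLine_le hm hk j y))
    intro n h
    have h2 : (1 : ℝ) = 4 * ((m : ℝ) * j) - 4 * k - 4 * ((m : ℝ) * n) := by linarith
    have h3 : (1 : ℤ) = 4 * ((m : ℤ) * j) - 4 * k - 4 * ((m : ℤ) * n) := by exact_mod_cast h2
    omega
  case hintb =>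
    refine fo_integrable_line (B := 1) hm k le_rfl ?_ (ne_of_gt hz₀) ?_
    · intro n h
      nlinarith [n.cast_nonneg (α := ℝ), k.cast_nonneg (α := ℝ)]
    · intro y
      rw [show ((((1 / 2 : ℝ)) : ℂ)) = 1 / 2 by push_cast; ring]
      exact (lemma_4_7_norm hm k y).le
  case hdecay =>
    intro ε hε
    obtain ⟨K, hK, hKb⟩ := exists_norm_rhoFactor_le_of_le_abs_im hm k (1 / 2 - 2 * m * j)
    refine ⟨max (max (2 * m) (|z₀.im| + 1)) (K / (2 * ε)), fun T hT x hx => ?_⟩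
    have hT2 : 2 * (m : ℝ) ≤ |T| := le_trans (le_trans (le_max_left _ _) (le_max_left _ _)) hT
    have hTi : |z₀.im| + 1 ≤ |T| := le_trans (le_trans (le_max_right _ _) (le_max_left _ _)) hT
    have hTK : K / (2 * ε) ≤ |T| := le_trans (le_max_right _ _) hT
    have hT0 : 0 < |T| := by linarith [abs_nonneg z₀.im]
    set z : ℂ := (x : ℂ) + T * I with hzdef
    have him : z.im = T := by simp [hzdef]
    -- `|z − z₀| ≥ |T − Im z₀| ≥ 1` and `|2z − 3| ≥ 2|T|`
    have hzz : 1 ≤ ‖z - z₀‖ := by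
      have h1 := Complex.abs_im_le_norm (z - z₀)
      rw [sub_im, him] at h1
      have h2 : |T| - |z₀.im| ≤ |T - z₀.im| := abs_sub_abs_le_abs_sub T z₀.im
      linarith
    have h2T : 2 * |T| ≤ ‖2 * z - 3‖ := by
      have := fo_two_abs_im_le z
      rwa [him] at this
    simp only [hF]
    rw [norm_div, norm_mul]
    have hden : 0 < ‖z - z₀‖ * ‖2 * z - 3‖ := by
      have : 0 < ‖2 * z - 3‖ := by linarith
      positivity
    calc ‖rhoFactor m k z‖ / (‖z - z₀‖ * ‖2 * z - 3‖)
        ≤ K / (1 * (2 * |T|)) := by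
          refine div_le_div₀ hK.le (hKb x hx T hT2) (by positivity) ?_
          exact mul_le_mul hzz h2T (by positivity) (norm_nonneg _)
      _ ≤ ε := by
          rw [one_mul, div_le_iff₀ (by positivity)]
          have := (div_le_iff₀ (by positivity : (0:ℝ) < 2 * ε)).1 hTK
          linarith


/-- RH-FREE. **The integral over the left side `Re w = ½ − 2mj` tends to `0`**: for `j` large,
`|w − z₀| ≥ |2w − 3|/4` on that line, so the integrand is `≤ 4(16π²/3)⁴/|2w − 3|²`, whose integral is
`4(16π²/3)⁴ · π/(2(4mj+2)) → 0`. [cite: ConnesConsani2021QuasiInner, §2 (arXiv chunk p0005:L80–L88) with Lemma 4.7 (p0014:L56)] -/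
theorem tendsto_integral_rhoFactor_cauchy_leftLine {m : ℕ} (hm : 0 < m) {k : ℕ} (hk : k < m) (z₀ : ℂ) :
    Tendsto (fun j : ℕ => ∫ y : ℝ, rhoFactor m k ((((1 / 2 - 2 * m * j : ℝ)) : ℂ) + y * I) /
        ((((((1 / 2 - 2 * m * j : ℝ)) : ℂ) + y * I) - z₀) * (2 * ((((1 / 2 - 2 * m * j : ℝ)) : ℂ) + y * I) - 3)))
      atTop (𝓝 0) := by
  have hm0 : (0 : ℝ) < m := Nat.cast_pos.mpr hm
  set C : ℝ := (16 * π ^ 2 / 3) ^ 4 with hC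
  have hπ := Real.pi_pos
  have hbase : (1 : ℝ) ≤ 16 * π ^ 2 / 3 := by nlinarith [Real.pi_gt_three]
  have hev : ∀ᶠ j : ℕ in atTop, ‖2 * z₀ - 3‖ ≤ 2 * m * (j : ℝ) := by
    have ht : Tendsto (fun j : ℕ => 2 * m * (j : ℝ)) atTop atTop :=
      tendsto_natCast_atTop_atTop.const_mul_atTop (by positivity)
    exact ht.eventually_ge_atTop _
  have hbound : ∀ᶠ j : ℕ in atTop, ‖∫ y : ℝ, rhoFactor m k ((((1 / 2 - 2 * m * j : ℝ)) : ℂ) + y * I) /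
        ((((((1 / 2 - 2 * m * j : ℝ)) : ℂ) + y * I) - z₀) * (2 * ((((1 / 2 - 2 * m * j : ℝ)) : ℂ) + y * I) - 3))‖ ≤
      4 * C * (π / (2 * (4 * m * j + 2))) := by
    filter_upwards [hev] with j hj
    have hc : (0 : ℝ) < 4 * m * j + 2 := by positivity
    have hg : Integrable fun y : ℝ => 4 * C * ((4 * m * j + 2) ^ 2 + 4 * y ^ 2)⁻¹ := by
      have hcont : Continuous fun y : ℝ => ((4 * (m : ℝ) * j + 2) ^ 2 + 4 * y ^ 2)⁻¹ :=
        Continuous.inv₀ (by fun_prop) fun y => by positivity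
      refine (Integrable.mono' (integrable_inv_one_add_sq.const_mul (4⁻¹))
        hcont.aestronglyMeasurable (Eventually.of_forall fun y => ?_)).const_mul (4 * C)
      rw [Real.norm_eq_abs, abs_of_pos (by positivity)]
      have h2 : (2 : ℝ) ≤ 4 * (m : ℝ) * j + 2 := by
        have : (0 : ℝ) ≤ 4 * (m : ℝ) * j := by positivity
        linarith
      have : 4 * (1 + y ^ 2) ≤ (4 * (m : ℝ) * j + 2) ^ 2 + 4 * y ^ 2 := by nlinarith [h2]
      calc ((4 * (m : ℝ) * j + 2) ^ 2 + 4 * y ^ 2)⁻¹ ≤ (4 * (1 + y ^ 2))⁻¹ := inv_anti₀ (by positivity) this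
        _ = 4⁻¹ * (1 + y ^ 2)⁻¹ := mul_inv _ _
    refine (norm_integral_le_of_norm_le hg (Eventually.of_forall fun y => ?_)).trans (le_of_eq ?_)
    · set z : ℂ := (((1 / 2 - 2 * m * j : ℝ)) : ℂ) + y * I with hzdef
      have hsq : ‖2 * z - 3‖ ^ 2 = (4 * m * j + 2) ^ 2 + 4 * y ^ 2 := by
        rw [fo_normSq_two_mul_sub_three]
        simp [hzdef]
        ring
      have h2 : 2 + 4 * (m : ℝ) * j ≤ ‖2 * z - 3‖ := by
        have := Complex.abs_re_le_norm (2 * z - 3)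
        have hre' : (2 * z - 3).re = -(2 + 4 * m * j) := by simp [hzdef]; ring
        rw [hre', abs_neg, abs_of_pos (by positivity)] at this
        exact this
      have h23 : 0 < ‖2 * z - 3‖ := by
        have : (0 : ℝ) < 2 + 4 * (m : ℝ) * j := by positivity
        linarith
      have hzz : ‖2 * z - 3‖ ≤ 4 * ‖z - z₀‖ := by
        have e : 2 * z - 3 = 2 * (z - z₀) + (2 * z₀ - 3) := by ring
        have h1 : ‖2 * z - 3‖ ≤ 2 * ‖z - z₀‖ + ‖2 * z₀ - 3‖ := by
          rw [e]
          refine (norm_add_le _ _).trans ?_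
          rw [norm_mul, Complex.norm_ofNat]
        nlinarith [norm_nonneg (z - z₀)]
      have hzz0 : 0 < ‖z - z₀‖ := by linarith
      rw [norm_div, norm_mul]
      calc ‖rhoFactor m k z‖ / (‖z - z₀‖ * ‖2 * z - 3‖)
          ≤ C / (‖2 * z - 3‖ / 4 * ‖2 * z - 3‖) := by
            refine div_le_div₀ (by positivity) ?_ (by positivity) ?_
            · exact (norm_rhoFactor_leftLine_le hm hk j y).trans (pow_le_pow_right₀ hbase (min_le_right j 4))
            · exact mul_le_mul_of_nonneg_right (by linarith) (norm_nonneg _)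
        _ = 4 * C * (‖2 * z - 3‖ ^ 2)⁻¹ := by
            field_simp
        _ = 4 * C * ((4 * m * j + 2) ^ 2 + 4 * y ^ 2)⁻¹ := by rw [hsq]
    · rw [integral_const_mul, fo_integral_inv_sq_add_four_mul_sq hc]
  have hlim : Tendsto (fun j : ℕ => 4 * C * (π / (2 * (4 * m * (j : ℝ) + 2)))) atTop (𝓝 0) := by
    have h1 : Tendsto (fun j : ℕ => 2 * (4 * m * (j : ℝ) + 2)) atTop atTop := by
      have h8 : Tendsto (fun j : ℕ => 8 * m * (j : ℝ) + 4) atTop atTop :=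
        tendsto_atTop_add_const_right _ 4
          (tendsto_natCast_atTop_atTop.const_mul_atTop (by positivity : (0:ℝ) < 8 * m))
      refine h8.congr fun j => ?_
      ring
    have h2 : Tendsto (fun j : ℕ => π / (2 * (4 * m * (j : ℝ) + 2))) atTop (𝓝 0) :=
      tendsto_const_nhds.div_atTop h1
    simpa using h2.const_mul (4 * C)
  exact squeeze_zero_norm' hbound hlim

/-- RH-FREE. **`∫_{∂ℂ₋} ρ_∞^{(m,k)}(w) dw/((w − z₀)(2w − 3))` as the series of residues** (`R → ∞`, `j → ∞`):
`∫_ℝ H(½+iy)dy = 2π (Σ_n r_n/((p_n − z₀)(2p_n − 3)) + ρ_∞^{(m,k)}(z₀)/(2z₀ − 3))` whenever `Σ|r_n| < ∞`,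
for `Re z₀ < ½` not a pole. [cite: ConnesConsani2021QuasiInner, §2 (arXiv chunk p0005:L88–L108) with Thm 4.8 proof (p0014:L64)] -/
theorem integral_rhoFactor_cauchy_criticalLine_eq {m : ℕ} (hm : 0 < m) {k : ℕ} (hk : k < m) (r : ℕ → ℂ)
    (hpole : ∀ n : ℕ, ∃ Φ : ℂ → ℂ,
      DifferentiableOn ℂ Φ (Metric.ball (-(2 * (k : ℂ) + 2 * (m : ℂ) * (n : ℂ))) 1) ∧
      Φ (-(2 * (k : ℂ) + 2 * (m : ℂ) * (n : ℂ))) = r n ∧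
      ∀ z ∈ Metric.ball (-(2 * (k : ℂ) + 2 * (m : ℂ) * (n : ℂ))) 1, z ≠ -(2 * (k : ℂ) + 2 * (m : ℂ) * (n : ℂ)) →
        rhoFactor m k z = Φ z / (z - -(2 * (k : ℂ) + 2 * (m : ℂ) * (n : ℂ))))
    (hsum : Summable fun n : ℕ => ‖r n‖) {z₀ : ℂ} (hz₀ : z₀.re < 1 / 2) (hG₀ : gammaFactor m k z₀ ≠ 0) :
    ∫ y : ℝ, rhoFactor m k ((((1 / 2 : ℝ)) : ℂ) + y * I) /
        ((((((1 / 2 : ℝ)) : ℂ) + y * I) - z₀) * (2 * ((((1 / 2 : ℝ)) : ℂ) + y * I) - 3)) =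
      2 * π * (∑' n : ℕ, r n /
          ((-(2 * (k : ℂ) + 2 * (m : ℂ) * (n : ℂ)) - z₀) * (2 * (-(2 * (k : ℂ) + 2 * (m : ℂ) * (n : ℂ))) - 3)) +
        rhoFactor m k z₀ / (2 * z₀ - 3)) := by
  have hm0 : (0 : ℝ) < m := Nat.cast_pos.mpr hm
  set Ib : ℂ := ∫ y : ℝ, rhoFactor m k ((((1 / 2 : ℝ)) : ℂ) + y * I) /
        ((((((1 / 2 : ℝ)) : ℂ) + y * I) - z₀) * (2 * ((((1 / 2 : ℝ)) : ℂ) + y * I) - 3)) with hIb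
  set L : ℕ → ℂ := fun j => ∫ y : ℝ, rhoFactor m k ((((1 / 2 - 2 * m * j : ℝ)) : ℂ) + y * I) /
        ((((((1 / 2 - 2 * m * j : ℝ)) : ℂ) + y * I) - z₀) * (2 * ((((1 / 2 - 2 * m * j : ℝ)) : ℂ) + y * I) - 3))
    with hL
  set P : ℕ → ℂ := fun n => -(2 * (k : ℂ) + 2 * (m : ℂ) * (n : ℂ)) with hP
  set term : ℕ → ℂ := fun n => r n / ((P n - z₀) * (2 * P n - 3)) with hterm
  have hsum' : Summable term := by
    refine Summable.of_norm_bounded_eventually (hsum.mul_left (1 / 3)) ?_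
    rw [Nat.cofinite_eq_atTop]
    have hev : ∀ᶠ n : ℕ in atTop, ‖z₀‖ + 1 ≤ 2 * k + 2 * m * (n : ℝ) := by
      have ht : Tendsto (fun n : ℕ => 2 * (k : ℝ) + 2 * m * (n : ℝ)) atTop atTop :=
        tendsto_atTop_add_const_left _ _ (tendsto_natCast_atTop_atTop.const_mul_atTop (by positivity))
      exact ht.eventually_ge_atTop _
    filter_upwards [hev] with n hn
    have hPn : ‖P n‖ = 2 * k + 2 * m * n := by
      simp only [hP]
      rw [norm_neg, show (2 * (k : ℂ) + 2 * (m : ℂ) * (n : ℂ)) = (((2 * k + 2 * m * n : ℝ)) : ℂ) by push_cast; ring,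
        Complex.norm_real, Real.norm_eq_abs, abs_of_nonneg (by positivity)]
    have h1 : 1 ≤ ‖P n - z₀‖ := by
      have := norm_sub_norm_le (P n) z₀
      linarith
    have h3 : 3 ≤ ‖2 * P n - 3‖ := by
      have := Complex.abs_re_le_norm (2 * P n - 3)
      have hre' : (2 * P n - 3).re = -(4 * k + 4 * m * n + 3) := by simp [hP]; ring
      rw [hre', abs_neg, abs_of_pos (by positivity)] at this
      nlinarith [k.cast_nonneg (α := ℝ), n.cast_nonneg (α := ℝ), hm0]
    simp only [hterm]
    rw [norm_div, norm_mul]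
    calc ‖r n‖ / (‖P n - z₀‖ * ‖2 * P n - 3‖) ≤ ‖r n‖ / (1 * 3) :=
          div_le_div_of_nonneg_left (norm_nonneg _) (by norm_num) (mul_le_mul h1 h3 (by norm_num) (by positivity))
      _ = 1 / 3 * ‖r n‖ := by ring
  have hS : HasSum term (∑' n, term n) := hsum'.hasSum
  have hjev : ∀ᶠ j : ℕ in atTop, 1 ≤ j ∧ (1 / 2 - 2 * m * j : ℝ) < z₀.re := by
    have ht : Tendsto (fun j : ℕ => 2 * m * (j : ℝ)) atTop atTop :=
      tendsto_natCast_atTop_atTop.const_mul_atTop (by positivity)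
    filter_upwards [eventually_ge_atTop 1, ht.eventually_gt_atTop (1 / 2 - z₀.re)] with j hj hj'
    exact ⟨hj, by linarith⟩
  have hconst : ∀ᶠ j : ℕ in atTop,
      L j + 2 * π * (∑ n ∈ Finset.range j, term n + rhoFactor m k z₀ / (2 * z₀ - 3)) = Ib := by
    filter_upwards [hjev] with j hj
    have h : Ib - L j = 2 * π * (∑ n ∈ Finset.range j, term n + rhoFactor m k z₀ / (2 * z₀ - 3)) :=
      integral_rhoFactor_cauchy_line_sub_eq_sum hm hk r hpole hz₀ hG₀ j hj.1 hj.2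
    linear_combination (-1 : ℂ) * h
  have hlim : Tendsto (fun j : ℕ => L j + 2 * π * (∑ n ∈ Finset.range j, term n + rhoFactor m k z₀ / (2 * z₀ - 3)))
      atTop (𝓝 (0 + 2 * π * (∑' n, term n + rhoFactor m k z₀ / (2 * z₀ - 3)))) :=
    (tendsto_integral_rhoFactor_cauchy_leftLine hm hk z₀).add
      ((hS.tendsto_sum_nat.add tendsto_const_nhds).const_mul _)
  rw [zero_add] at hlim
  have hlim' : Tendsto (fun j : ℕ => L j + 2 * π * (∑ n ∈ Finset.range j, term n + rhoFactor m k z₀ / (2 * z₀ - 3)))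
      atTop (𝓝 Ib) :=
    tendsto_const_nhds.congr' (EventuallyEq.symm hconst)
  exact tendsto_nhds_unique hlim' hlim

/-- RH-FREE. `ψ⁻¹(a) − ψ⁻¹(b) = −8(a − b)/((2a − 3)(2b − 3))`. [cite: ConnesConsani2021QuasiInner, Introduction (arXiv chunk p0003:L26)] -/
theorem cayleyInv_sub_cayleyInv {a b : ℂ} (ha : a ≠ 3 / 2) (hb : b ≠ 3 / 2) :
    cayleyInv a - cayleyInv b = -8 * (a - b) / ((2 * a - 3) * (2 * b - 3)) := by
  have ha' : 2 * a - 3 ≠ 0 := by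
    intro h; apply ha; linear_combination h / 2
  have hb' : 2 * b - 3 ≠ 0 := by
    intro h; apply hb; linear_combination h / 2
  rw [cayleyInv, cayleyInv, div_sub_div _ _ ha' hb']
  congr 1
  ring

/-- RH-FREE. The boundary function `f_x|S¹ = ξ_x` (`f_x(v) = v⁻¹(1 − xv⁻¹)⁻¹ = 1/(v − x)`, `|x| < 1`) is continuous on
the circle and its `L²` class is the vector `ξ_x`: `ξ_x =ᵐ f_x ∘ e^{2πi·}`. [cite: ConnesConsani2021QuasiInner, Lemma 2.2 (arXiv chunk p0006:L11–L14)] -/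
theorem coeFn_xiVec_ae_eq {x : ℂ} (hx : ‖x‖ < 1) :
    ((xiVec 1 x : Lp ℂ 2 (haarAddCircle (T := 1))) : AddCircle (1:ℝ) → ℂ) =ᵐ[haarAddCircle (T := 1)]
      circleRestrict 1 (szegoNeg x) := by
  have hv : ∀ y : AddCircle (1:ℝ), ‖((toCircle y : Circle) : ℂ)‖ = 1 := fun y => Circle.norm_coe _
  have hv0 : ∀ y : AddCircle (1:ℝ), ((toCircle y : Circle) : ℂ) ≠ 0 := fun y =>
    norm_ne_zero_iff.mp (by rw [hv y]; exact one_ne_zero)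
  have h1 : ∀ y : AddCircle (1:ℝ), 1 - x * (((toCircle y : Circle) : ℂ))⁻¹ ≠ 0 := by
    intro y h
    have : ‖x * (((toCircle y : Circle) : ℂ))⁻¹‖ = 1 := by rw [← sub_eq_zero.mp h, norm_one]
    rw [norm_mul, norm_inv, hv y, inv_one, mul_one] at this
    linarith
  have hcont : Continuous (circleRestrict 1 (szegoNeg x)) := by
    have hc : Continuous fun y : AddCircle (1:ℝ) => ((toCircle y : Circle) : ℂ) :=
      continuous_subtype_val.comp continuous_toCircle
    have e : circleRestrict 1 (szegoNeg x) = fun y : AddCircle (1:ℝ) =>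
        (((toCircle y : Circle) : ℂ))⁻¹ * (1 - x * (((toCircle y : Circle) : ℂ))⁻¹)⁻¹ := rfl
    rw [e]
    exact (hc.inv₀ hv0).mul ((continuous_const.sub (continuous_const.mul (hc.inv₀ hv0))).inv₀ h1)
  have hbd : ∀ y, ‖circleRestrict 1 (szegoNeg x) y‖ ≤ (1 - ‖x‖)⁻¹ := by
    intro y
    have e : circleRestrict 1 (szegoNeg x) y =
        (((toCircle y : Circle) : ℂ))⁻¹ * (1 - x * (((toCircle y : Circle) : ℂ))⁻¹)⁻¹ := rfl
    rw [e, norm_mul, norm_inv, hv y, inv_one, one_mul, norm_inv]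
    refine inv_anti₀ (by linarith) ?_
    have := norm_sub_norm_le (1 : ℂ) (x * (((toCircle y : Circle) : ℂ))⁻¹)
    rw [norm_one, norm_mul, norm_inv, hv y, inv_one, mul_one] at this
    exact this
  have hmemTop : MemLp (circleRestrict 1 (szegoNeg x)) ∞ (haarAddCircle (T := 1)) :=
    memLp_top_of_bound hcont.aestronglyMeasurable _ (ae_of_all _ hbd)
  have hmem : MemLp (circleRestrict 1 (szegoNeg x)) 2 (haarAddCircle (T := 1)) :=
    hmemTop.mono_exponent le_top
  rw [xiVec, toLpOrZero_eq_toLp hmem]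
  exact hmem.coeFn_toLp

/-- RH-FREE. **The Cauchy integral of `κ^{(m,k)} = ρ_∞^{(m,k)} ∘ ψ` against `f_x`**: for `x = ψ⁻¹(z₀)`,
`Re z₀ < ½` not a pole of `ρ_∞^{(m,k)}`,
`⟨e_{−1} | κ^{(m,k)} ξ_x⟩ = (1/2πi)∮_{S¹} κ^{(m,k)}(v) dv/(v − x) = ρ_∞^{(m,k)}(z₀) + (2z₀ − 3) Σ_n r_n/((p_n − z₀)(2p_n − 3))`
(change of variables to the critical line and the residue series above; the term `ρ_∞^{(m,k)}(z₀)` is the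
residue at the pole `z₀ = ψ(x)` of `1/(v − x)`).
[cite: ConnesConsani2021QuasiInner, §2 «Changing variables» (arXiv chunk p0005:L34–L44) with Thm 4.8 proof (p0014:L64)] -/
theorem inner_fourierLp_negOne_mulOp_rhoFactor_xiVec {m : ℕ} (hm : 0 < m) {k : ℕ} (hk : k < m) (r : ℕ → ℂ)
    (hpole : ∀ n : ℕ, ∃ Φ : ℂ → ℂ,
      DifferentiableOn ℂ Φ (Metric.ball (-(2 * (k : ℂ) + 2 * (m : ℂ) * (n : ℂ))) 1) ∧
      Φ (-(2 * (k : ℂ) + 2 * (m : ℂ) * (n : ℂ))) = r n ∧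
      ∀ z ∈ Metric.ball (-(2 * (k : ℂ) + 2 * (m : ℂ) * (n : ℂ))) 1, z ≠ -(2 * (k : ℂ) + 2 * (m : ℂ) * (n : ℂ)) →
        rhoFactor m k z = Φ z / (z - -(2 * (k : ℂ) + 2 * (m : ℂ) * (n : ℂ))))
    (hsum : Summable fun n : ℕ => ‖r n‖) {z₀ : ℂ} (hz₀ : z₀.re < 1 / 2) (hG₀ : gammaFactor m k z₀ ≠ 0) :
    ⟪fourierLp (T := 1) 2 (-1), mulOp haarAddCircle
        (toLpOrZero ∞ haarAddCircle (circleRestrict 1 (rhoFactor m k ∘ cayley))) (xiVec 1 (cayleyInv z₀))⟫_ℂ =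
      rhoFactor m k z₀ + (2 * z₀ - 3) * ∑' n : ℕ, r n /
          ((-(2 * (k : ℂ) + 2 * (m : ℂ) * (n : ℂ)) - z₀) * (2 * (-(2 * (k : ℂ) + 2 * (m : ℂ) * (n : ℂ))) - 3)) := by
  have hπ : (π : ℂ) ≠ 0 := ofReal_ne_zero.mpr Real.pi_pos.ne'
  set x : ℂ := cayleyInv z₀ with hxdef
  have hB0 : 2 * z₀ - 3 ≠ 0 := by
    intro h; have := congrArg Complex.re h; simp at this; linarith
  have hx : ‖x‖ < 1 := by
    rw [hxdef, cayleyInv, norm_div, div_lt_one (norm_pos_iff.mpr hB0)]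
    have h1 : ‖2 * z₀ + 1‖ ^ 2 < ‖2 * z₀ - 3‖ ^ 2 := by
      rw [Complex.sq_norm, Complex.sq_norm, normSq_apply, normSq_apply]
      simp
      nlinarith
    exact (pow_lt_pow_iff_left₀ (norm_nonneg _) (norm_nonneg _) two_ne_zero).1 h1
  set u : Lp ℂ ∞ (haarAddCircle (T := 1)) :=
    toLpOrZero ∞ haarAddCircle (circleRestrict 1 (rhoFactor m k ∘ cayley)) with hudef
  set v := mulOp haarAddCircle u (xiVec 1 x) with hvdef
  -- `⟨e_{−1} | v⟩` is the Fourier coefficient of index `−1` of `v = κ f_x`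
  have key : ⟪fourierLp (T := 1) 2 (-1), v⟫_ℂ = fourierCoeff (T := 1) (v : AddCircle (1:ℝ) → ℂ) (-1) := by
    rw [← fourierBasis_repr, ← coe_fourierBasis]
    exact (fourierBasis.repr_apply_apply v (-1)).symm
  set g : ℂ → ℂ := fun w => rhoFactor m k (cayley w) * szegoNeg x w with hgdef
  have hmem := memLp_circleRestrict_rhoFactor hm k
  have hu : ((u : Lp ℂ ∞ (haarAddCircle (T := 1))) : AddCircle (1:ℝ) → ℂ) =ᵐ[haarAddCircle (T := 1)]
      circleRestrict 1 (rhoFactor m k ∘ cayley) := by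
    rw [hudef, toLpOrZero_eq_toLp hmem]
    exact hmem.coeFn_toLp
  have hae : ((v : Lp ℂ 2 (haarAddCircle (T := 1))) : AddCircle (1:ℝ) → ℂ) =ᵐ[haarAddCircle (T := 1)]
      circleRestrict 1 g := by
    filter_upwards [coeFn_mulOp haarAddCircle u (xiVec 1 x), hu, coeFn_xiVec_ae_eq hx] with y h1 h2 h3
    rw [h1, h2, h3]
    rfl
  rw [key, fourierCoeff_congr_ae 1 hae]
  have hcov := fourierCoeff_circleRestrict_neg_eq_integral g 1
  simp only [Nat.cast_one, pow_one] at hcov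
  rw [hcov]
  -- pointwise identification of the integrand with `((2z₀ − 3)/(2π)) · ρ(z)/((z − z₀)(2z − 3))`
  have hpt : ∀ t : ℝ, (((π⁻¹ * (1 + t ^ 2)⁻¹ : ℝ)) : ℂ) *
      (cayleyInv (1 / 2 + t * I) * g (cayleyInv (1 / 2 + t * I))) =
      (2 * z₀ - 3) / (2 * π) * (rhoFactor m k ((((1 / 2 : ℝ)) : ℂ) + t * I) /
        ((((((1 / 2 : ℝ)) : ℂ) + t * I) - z₀) * (2 * ((((1 / 2 : ℝ)) : ℂ) + t * I) - 3))) := by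
    intro t
    set z : ℂ := 1 / 2 + (t : ℂ) * I with hzD
    have hz : z ≠ 3 / 2 := by
      intro h
      have := congrArg Complex.re h
      rw [hzD] at this
      simp at this
      norm_num at this
    have h12 : ((((1 / 2 : ℝ)) : ℂ)) + (t : ℂ) * I = z := by rw [hzD]; push_cast; ring
    rw [h12, hgdef]
    dsimp only
    rw [cayley_cayleyInv hz]
    set A : ℂ := 2 * z + 1 with hA
    set B : ℂ := 2 * z - 3 with hB
    have hA0 : A ≠ 0 := by
      intro h
      have := congrArg Complex.re h
      rw [hA, hzD] at this
      norm_num at this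
    have hBne : B ≠ 0 := by
      intro h
      have := congrArg Complex.re h
      rw [hB, hzD] at this
      norm_num at this
    have hzz : z - z₀ ≠ 0 := by
      intro h
      have := congrArg Complex.re h
      rw [hzD] at this
      simp at this
      linarith
    have hV : cayleyInv z = A / B := by rw [cayleyInv, hA, hB]
    have hq : (((1 + t ^ 2 : ℝ)) : ℂ) = -(A * B) / 4 := by
      rw [hA, hB, hzD]
      push_cast
      linear_combination ((t : ℂ) ^ 2) * I_sq
    have hcast : (((π⁻¹ * (1 + t ^ 2)⁻¹ : ℝ)) : ℂ) = (π : ℂ)⁻¹ * ((((1 + t ^ 2 : ℝ)) : ℂ))⁻¹ := by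
      push_cast; ring
    -- `1 − x V⁻¹ = −8 (z − z₀)/(A (2 z₀ − 3))`
    have hx' : x = (2 * z₀ + 1) / (2 * z₀ - 3) := by rw [hxdef, cayleyInv]
    have h8 : (-8 : ℂ) * (z - z₀) ≠ 0 := mul_ne_zero (by norm_num) hzz
    have h1x : 1 - x * (A / B)⁻¹ = -8 * (z - z₀) / (A * (2 * z₀ - 3)) := by
      rw [hx', inv_div, eq_div_iff (mul_ne_zero hA0 hB0)]
      field_simp
      rw [hA, hB]
      ring
    have hsz : szegoNeg x (A / B) = B * (2 * z₀ - 3) / (-8 * (z - z₀)) := by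
      rw [szegoNeg]
      show (A / B)⁻¹ * (1 - x * (A / B)⁻¹)⁻¹ = B * (2 * z₀ - 3) / (-8 * (z - z₀))
      rw [h1x, inv_div, inv_div]
      field_simp
    have hq0 : -(A * B) / 4 ≠ 0 := div_ne_zero (neg_ne_zero.mpr (mul_ne_zero hA0 hBne)) (by norm_num)
    rw [hcast, hq, hV, hsz]
    field_simp
    ring
  simp_rw [hpt]
  rw [integral_const_mul, integral_rhoFactor_cauchy_criticalLine_eq hm hk r hpole hsum hz₀ hG₀]
  field_simp
  ring

end Contour

/-! ### C. The eigenvector identity for `κ^{(m,k)}` -/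

section Eigenvector

/-- RH-FREE. `|ψ⁻¹(z)| < 1` for `Re z < ½` (`ψ⁻¹` maps `ℂ₋` into the disc).
[cite: ConnesConsani2021QuasiInner, Introduction (arXiv chunk p0003:L26)] -/
theorem norm_cayleyInv_lt_one_of_re_lt_half {z : ℂ} (hz : z.re < 1 / 2) : ‖cayleyInv z‖ < 1 := by
  have hB0 : 2 * z - 3 ≠ 0 := by
    intro h; have := congrArg Complex.re h; simp at this; linarith
  rw [cayleyInv, norm_div, div_lt_one (norm_pos_iff.mpr hB0)]
  have h1 : ‖2 * z + 1‖ ^ 2 < ‖2 * z - 3‖ ^ 2 := by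
    rw [Complex.sq_norm, Complex.sq_norm, normSq_apply, normSq_apply]
    simp
    nlinarith
  exact (pow_lt_pow_iff_left₀ (norm_nonneg _) (norm_nonneg _) two_ne_zero).1 h1

/-- RH-FREE. The geometry of the poles in the disk (t17's computation): for `p = −q`, `q ≥ 0`,
`y = ψ⁻¹(p) = (2p+1)/(2p−3)` satisfies `|y| ≤ 1 − 2/(2q+3)` and `|2p − 3| = 2q + 3`. [folklore] -/
private theorem fo_pole_geometry {q : ℝ} (hq : 0 ≤ q) :
    ‖(2 * (-((q : ℝ) : ℂ)) + 1) / (2 * (-((q : ℝ) : ℂ)) - 3)‖ ≤ 1 - 2 / (2 * q + 3) ∧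
      ‖2 * (-((q : ℝ) : ℂ)) - 3‖ = 2 * q + 3 := by
  have h3 : 2 * (-((q : ℝ) : ℂ)) - 3 = (((-(2 * q + 3) : ℝ)) : ℂ) := by push_cast; ring
  have h1 : 2 * (-((q : ℝ) : ℂ)) + 1 = (((-(2 * q - 1) : ℝ)) : ℂ) := by push_cast; ring
  have hpos : 0 < 2 * q + 3 := by linarith
  rw [h3, h1, norm_div, Complex.norm_real, Complex.norm_real, Real.norm_eq_abs, Real.norm_eq_abs, abs_neg,
    abs_neg, abs_of_pos hpos]
  refine ⟨?_, rfl⟩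
  rw [div_le_iff₀ hpos, show (1 - 2 / (2 * q + 3)) * (2 * q + 3) = 2 * q + 1 by field_simp; ring]
  exact abs_le.2 ⟨by linarith, by linarith⟩

/-- RH-FREE. **The Cauchy kernels are eigenvectors of `(1 − 𝒫) M_{κ^{(m,k)}} (1 − 𝒫)` modulo the polar
part.**  Let `0 ≤ k < m`, `Re z₀ < ½` with `x = ψ⁻¹(z₀) ∈ 𝔻` NON-REAL (so `z₀` is not one of the real
poles `p_n = −2k − 2mn`), and let `r_n` be the residues of `ρ_∞^{(m,k)}` at `p_n` (concrete form
`ρ = Φ/(w − p_n)`, `Σ|r_n| < ∞`; t17's `exists_rhoFactor_eq_div_sub_pole` / `norm_rhoFactor_residue_le`),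
`y_n = ψ⁻¹(p_n) = (2p_n+1)/(2p_n−3)`, `c_n = −8r_n/(2p_n−3)²`.  Then, for `κ^{(m,k)} = ρ_∞^{(m,k)} ∘ ψ|S¹`,
`(1 − 𝒫)(κ^{(m,k)} ξ_x) = ρ_∞^{(m,k)}(z₀) ξ_x − Σ_n (c_n/(x − y_n)) ξ_{y_n}`
(§A with the negative Fourier coefficients `Σ c_n y_n^ℓ` of `κ^{(m,k)}` (t17's `hasSum_fourierCoeff_rhoFactor`)
and the identification `⟨e_{−1} | κ^{(m,k)} ξ_x⟩ + Σ c_n/(x − y_n) = ρ_∞^{(m,k)}(z₀)` of §B, via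
`ψ⁻¹(z₀) − ψ⁻¹(p_n) = −8(z₀ − p_n)/((2z₀−3)(2p_n−3))`).  For `x = x_p(n) = ψ⁻¹(2πin/log p)` (`n ≠ 0`) the
eigenvalue is `ρ_∞^{(m,k)}(2πin/log p)`, the `n`-th entry of the diagonal `D` of Theorems 4.4 (ii) / 4.8.
[cite: ConnesConsani2021QuasiInner, Thm 4.4 (ii) (arXiv chunk p0011:L98, proof p0012:L8–L21) and Thm 4.8 proof (p0014:L64); Lemma 2.2 (p0006:L11–L21)] -/
theorem mulOp_rhoFactor_xiVec_sub_hardyProjection {m : ℕ} (hm : 0 < m) {k : ℕ} (hk : k < m)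
    (r : ℕ → ℂ)
    (hpole : ∀ n : ℕ, ∃ Φ : ℂ → ℂ,
      DifferentiableOn ℂ Φ (Metric.ball (-(2 * (k : ℂ) + 2 * (m : ℂ) * (n : ℂ))) 1) ∧
      Φ (-(2 * (k : ℂ) + 2 * (m : ℂ) * (n : ℂ))) = r n ∧
      ∀ z ∈ Metric.ball (-(2 * (k : ℂ) + 2 * (m : ℂ) * (n : ℂ))) 1, z ≠ -(2 * (k : ℂ) + 2 * (m : ℂ) * (n : ℂ)) →
        rhoFactor m k z = Φ z / (z - -(2 * (k : ℂ) + 2 * (m : ℂ) * (n : ℂ))))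
    (hsum : Summable fun n : ℕ => ‖r n‖) {z₀ : ℂ} (hz₀ : z₀.re < 1 / 2) (him : (cayleyInv z₀).im ≠ 0) :
    mulOp haarAddCircle (toLpOrZero ∞ haarAddCircle (circleRestrict 1 (rhoFactor m k ∘ cayley)))
        (xiVec 1 (cayleyInv z₀)) -
      hardyProjection 1 (mulOp haarAddCircle
        (toLpOrZero ∞ haarAddCircle (circleRestrict 1 (rhoFactor m k ∘ cayley))) (xiVec 1 (cayleyInv z₀))) =
      rhoFactor m k z₀ • xiVec 1 (cayleyInv z₀) -
        ∑' n : ℕ, ((-8 * r n / (2 * (-(2 * (k : ℂ) + 2 * (m : ℂ) * (n : ℂ))) - 3) ^ 2) /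
            (cayleyInv z₀ - (2 * (-(2 * (k : ℂ) + 2 * (m : ℂ) * (n : ℂ))) + 1) /
              (2 * (-(2 * (k : ℂ) + 2 * (m : ℂ) * (n : ℂ))) - 3))) •
          xiVec 1 ((2 * (-(2 * (k : ℂ) + 2 * (m : ℂ) * (n : ℂ))) + 1) / (2 * (-(2 * (k : ℂ) + 2 * (m : ℂ) * (n : ℂ))) - 3)) := by
  have hm0 : (0 : ℝ) < m := Nat.cast_pos.mpr hm
  set x : ℂ := cayleyInv z₀ with hxdef
  have hx : ‖x‖ < 1 := norm_cayleyInv_lt_one_of_re_lt_half hz₀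
  set P : ℕ → ℂ := fun n => -(2 * (k : ℂ) + 2 * (m : ℂ) * (n : ℂ)) with hP
  set y : ℕ → ℂ := fun n => (2 * P n + 1) / (2 * P n - 3) with hydef
  set c : ℕ → ℂ := fun n => -8 * r n / (2 * P n - 3) ^ 2 with hcdef
  set u : Lp ℂ ∞ (haarAddCircle (T := 1)) :=
    toLpOrZero ∞ haarAddCircle (circleRestrict 1 (rhoFactor m k ∘ cayley)) with hudef
  -- the pole at `z₀` is off the real poles since `x` is non-real
  have hB0 : 2 * z₀ - 3 ≠ 0 := by
    intro h; have := congrArg Complex.re h; simp at this; linarith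
  have hG₀ : gammaFactor m k z₀ ≠ 0 := by
    intro h
    obtain ⟨n, hn⟩ := (gammaFactor_eq_zero_iff hm k z₀).1 h
    apply him
    rw [hxdef, hn, cayleyInv]
    have e : ((2 * (-2 * (k : ℂ) - 2 * (n : ℂ) * (m : ℂ)) + 1) / (2 * (-2 * (k : ℂ) - 2 * (n : ℂ) * (m : ℂ)) - 3)) =
        ((((2 * (-2 * k - 2 * n * m) + 1) / (2 * (-2 * k - 2 * n * m) - 3) : ℝ)) : ℂ) := by
      push_cast; ring
    rw [e, ofReal_im]
  have hPq : ∀ n : ℕ, P n = -(((2 * k + 2 * m * n : ℝ)) : ℂ) := by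
    intro n; simp only [hP]; push_cast; ring
  have hq : ∀ n : ℕ, (0 : ℝ) ≤ 2 * k + 2 * m * n := fun n => by positivity
  have hy : ∀ n : ℕ, ‖y n‖ < 1 := by
    intro n
    simp only [hydef]
    rw [hPq]
    refine ((fo_pole_geometry (hq n)).1).trans_lt ?_
    have : 0 < 2 / (2 * (2 * (k : ℝ) + 2 * m * n) + 3) := by positivity
    linarith
  have hyim : ∀ n : ℕ, (y n).im = 0 := by
    intro n
    simp only [hydef]
    rw [hPq]
    have e : (2 * -(((2 * k + 2 * m * n : ℝ)) : ℂ) + 1) / (2 * -(((2 * k + 2 * m * n : ℝ)) : ℂ) - 3) =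
        ((((2 * -(2 * k + 2 * m * n) + 1) / (2 * -(2 * k + 2 * m * n) - 3) : ℝ)) : ℂ) := by
      push_cast; ring
    rw [e, ofReal_im]
  have hs : Summable fun n : ℕ => ‖c n‖ * (1 - ‖y n‖)⁻¹ := by
    refine Summable.of_nonneg_of_le (fun n => ?_) (fun n => ?_) (hsum.mul_left (4 / 3))
    · exact mul_nonneg (norm_nonneg _) (inv_nonneg.mpr (by linarith [hy n]))
    · obtain ⟨hxle, h3⟩ := fo_pole_geometry (hq n)
      rw [← hPq] at hxle h3
      have hpos : (0 : ℝ) < 2 * (2 * k + 2 * m * n) + 3 := by positivity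
      have hcn : ‖c n‖ = 8 * ‖r n‖ / (2 * (2 * k + 2 * m * n) + 3) ^ 2 := by
        simp only [hcdef]
        rw [norm_div, norm_mul, norm_neg, norm_pow, h3]
        norm_num
      have hinv : (1 - ‖y n‖)⁻¹ ≤ (2 * (2 * k + 2 * m * n) + 3) / 2 := by
        rw [show (2 * (2 * (k : ℝ) + 2 * m * n) + 3) / 2 = (2 / (2 * (2 * (k : ℝ) + 2 * m * n) + 3))⁻¹ by
          rw [inv_div]]
        exact inv_anti₀ (by positivity) (by simp only [hydef]; linarith)
      calc ‖c n‖ * (1 - ‖y n‖)⁻¹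
          ≤ 8 * ‖r n‖ / (2 * (2 * k + 2 * m * n) + 3) ^ 2 * ((2 * (2 * k + 2 * m * n) + 3) / 2) :=
            mul_le_mul hcn.le hinv (inv_nonneg.mpr (by linarith [hy n])) (by positivity)
        _ = 4 * ‖r n‖ / (2 * (2 * k + 2 * m * n) + 3) := by
            field_simp
            ring
        _ ≤ 4 / 3 * ‖r n‖ := by
            rw [div_le_iff₀ hpos]
            nlinarith [mul_nonneg (hq n) (norm_nonneg (r n))]
  have hmem := memLp_circleRestrict_rhoFactor hm k
  have hae : ((u : Lp ℂ ∞ (haarAddCircle (T := 1))) : AddCircle (1:ℝ) → ℂ) =ᵐ[haarAddCircle (T := 1)]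
      circleRestrict 1 (rhoFactor m k ∘ cayley) := by
    rw [hudef, toLpOrZero_eq_toLp hmem]
    exact hmem.coeFn_toLp
  have hcoef : ∀ ℓ : ℕ, HasSum (fun n : ℕ => c n * y n ^ ℓ)
      (fourierCoeff (T := 1) ((u : Lp ℂ ∞ (haarAddCircle (T := 1))) : AddCircle (1:ℝ) → ℂ) (-(ℓ + 1 : ℤ))) := by
    intro ℓ
    have h := hasSum_fourierCoeff_rhoFactor hm hk r hpole hsum ℓ
    have e : (-((ℓ + 1 : ℕ) : ℤ)) = -(ℓ + 1 : ℤ) := by push_cast; ring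
    rw [e] at h
    rw [fourierCoeff_congr_ae 1 hae]
    exact h
  -- the distance from `x` to the real points `y_n` is at least `|Im x|`
  have hδ : 0 < |x.im| := abs_pos.mpr him
  have hxy : ∀ n, |x.im| ≤ ‖x - y n‖ := by
    intro n
    have h := Complex.abs_im_le_norm (x - y n)
    rwa [sub_im, hyim n, sub_zero] at h
  -- §A
  have hA := mulOp_xiVec_sub_hardyProjection u hy hs hcoef hx hδ hxy
  -- §B: the coefficient is `ρ_∞^{(m,k)}(z₀)`
  have hB := inner_fourierLp_negOne_mulOp_rhoFactor_xiVec hm hk r hpole hsum hz₀ hG₀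
  have hterm : ∀ n : ℕ, c n / (x - y n) = -(2 * z₀ - 3) * (r n / ((P n - z₀) * (2 * P n - 3))) := by
    intro n
    have hPz : P n - z₀ ≠ 0 := by
      intro h
      apply hG₀
      rw [gammaFactor_eq_zero_iff hm k]
      exact ⟨n, by rw [← sub_eq_zero.mp h]; simp only [hP]; ring⟩
    have hP3 : P n ≠ 3 / 2 := by
      intro h
      have := congrArg Complex.re h
      simp [hP] at this
      nlinarith [k.cast_nonneg (α := ℝ), n.cast_nonneg (α := ℝ), hm0]
    have hz3 : z₀ ≠ 3 / 2 := by
      intro h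
      have := congrArg Complex.re h
      simp at this
      linarith
    have hP3' : 2 * P n - 3 ≠ 0 := by
      intro h; apply hP3; linear_combination h / 2
    have hyx : x - y n = -8 * (z₀ - P n) / ((2 * z₀ - 3) * (2 * P n - 3)) := by
      have : y n = cayleyInv (P n) := by simp only [hydef, cayleyInv]
      rw [this, hxdef]
      exact cayleyInv_sub_cayleyInv hz3 hP3
    simp only [hcdef]
    rw [hyx]
    have h9 : -P n + z₀ ≠ 0 := by rw [neg_add_eq_sub]; exact fun h => hPz (by rw [← neg_sub, h, neg_zero])
    have h9' : z₀ - P n ≠ 0 := by rw [← neg_add_eq_sub]; exact h9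
    field_simp
    ring
  have hsumT : Summable fun n : ℕ => r n / ((P n - z₀) * (2 * P n - 3)) := by
    have hS0 := summable_coeff_div hy hs hδ hxy 0
    simp only [pow_zero, mul_one] at hS0
    have h := hS0.mul_left (-(2 * z₀ - 3))⁻¹
    refine h.congr fun n => ?_
    rw [hterm n, ← mul_assoc, inv_mul_cancel₀ (neg_ne_zero.mpr hB0), one_mul]
  have hcoefB : ⟪fourierLp (T := 1) 2 (-1), mulOp haarAddCircle u (xiVec 1 x)⟫_ℂ + ∑' n, c n / (x - y n) =
      rhoFactor m k z₀ := by
    rw [hudef, hxdef, hB]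
    simp_rw [← hxdef, hterm]
    rw [tsum_mul_left]
    simp only [hP]
    ring
  rw [hA, hcoefB]

end Eigenvector

end QuasiInner

end Literature.NumberTheory.ConnesConsani2021
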